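import Literature.Probability.LatticeModels.IsingPlusMixing
import Literature.Probability.LatticeModels.ImprovedTreeDiagramBoundProofs
import HarnessLib

/-!
# Plus-wall decoupling (line `Sketch-plus-wall-quotient-ladder`, stub S2 `stub_plusWallDecoupling`)

What: stub `stub_plusWallDecoupling` (S2) of the line `Sketch-plus-wall-quotient-ladder` for the crux
`SubPtolemyFloor` (item stmt-CriticalPhenomena-15703, route `SubPtolemyInterlacing`):
`⟨σ₀σ_{(2n+2)e₁}⟩⁺_{β_c(3),0} ≤ (⟨σ₀⟩⁺_{Λ_n;β_c(3),0})²` for `n ≥ 1`, where `Λ_n = box 3 n` is the box of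
radius `n` with plus boundary condition.

Proof: this is the tree theorem `plusCorr_union_shift_le` (Friedli–Velenik 2017, solution of
Exercise 3.15: for `A, B ⊆ Λ_L` and `‖x‖_∞ ≥ 2L + 2`, `⟨σ_{A ∪ (B+x)}⟩⁺ ≤ ⟨σ_A⟩⁺_{Λ_L}⟨σ_B⟩⁺_{Λ_L}` —
shrink the volume to the disconnected union `Λ_L ∪ (x + Λ_L)` by GKS, factorise, translate) at
`A = B = {0}`, `L = n`, `x = (2n+2)e₁` (so `‖x‖_∞ = 2n+2`), combined with
`⟨σ₀σ_x⟩⁺_{β,0} = ⟨σ_{{0,x}}⟩⁺_{β,0}` (`twoPointPlus_eq_plusCorr`, `x ≠ 0`).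
-/

noncomputable section

namespace Summit.CriticalPhenomena.Ising3DConformalLimit.SubPtolemyFloorPlusWall

open Literature.Probability.LatticeModels

/-- The pair `{0, x}` is `{0} ∪ ({0} + x)`, the shape of the index set in `plusCorr_union_shift_le`.
[folklore] -/
theorem pair_eq_singleton_union_map_shift {d : ℕ} (x : Site d) :
    ({0, x} : Finset (Site d)) = {0} ∪ ({0} : Finset (Site d)).map (Site.shift x).toEmbedding := by
  rw [Finset.map_singleton, Equiv.coe_toEmbedding, Site.shift_apply, zero_add, Finset.insert_eq]

/-- **S2 — plus-wall decoupling.** `⟨σ₀σ_{(2n+2)e₁}⟩_{β_c(3)} ≤ (⟨σ₀⟩⁺_{Λ_n;β_c,0})²`: the two boxes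
`Λ_n(0)`, `Λ_n((2n+2)e₁)` are at sup-distance `2`, freezing the spins off their union to `+` can only
raise the pair correlation (Griffiths' second inequality / plus correlations decrease in the volume), the
plus measure on the disconnected union factorises, and both factors are `M_n` by translation invariance
(all packaged in `plusCorr_union_shift_le`).
[cite: FriedliVelenik2017, §3.6–3.7 (GKS, monotonicity in the volume, Exercise 3.15)] -/
theorem stub_plusWallDecoupling :
    ∀ n : ℕ, 1 ≤ n →
      criticalTwoPoint 3 (((2 * n + 2 : ℕ) : ℤ) • (Pi.single 0 1 : Site 3)) ≤
        isingCorr (zdGraph 3) (box 3 n) (criticalBeta 3) 0 BoundaryCondition.plus {0} ^ 2 := by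
  intro n _
  -- `‖(2n+2) e₁‖_∞ = 2n + 2`
  have hnorm : Site.supNorm (((2 * n + 2 : ℕ) : ℤ) • (Pi.single 0 1 : Site 3)) = 2 * n + 2 := by
    rw [zsmul_single_zero_one, Site.supNorm_single, Int.natAbs_natCast]
  -- `(2n+2) e₁ ≠ 0`
  have hx0 : (((2 * n + 2 : ℕ) : ℤ) • (Pi.single 0 1 : Site 3)) ≠ 0 := by
    intro h0
    rw [h0, Site.supNorm_eq_zero_iff.2 rfl] at hnorm
    omega
  have h0 : ({0} : Finset (Site 3)) ⊆ box 3 n := Finset.singleton_subset_iff.2 (zero_mem_box 3 n)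
  have key := plusCorr_union_shift_le 3 (criticalBeta_nonneg 3) le_rfl h0 h0 hnorm.ge
  rw [← pair_eq_singleton_union_map_shift] at key
  show twoPointPlus 3 (criticalBeta 3) _ ≤ _
  rw [twoPointPlus_eq_plusCorr _ hx0, sq]
  exact key

end Summit.CriticalPhenomena.Ising3DConformalLimit.SubPtolemyFloorPlusWall

end
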